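import Literature.NumberTheory.QuadraticFields.FundamentalDiscriminant
import Literature.NumberTheory.QuadraticFields.SquareRootGenerator
import Literature.NumberTheory.QuadraticFields.UnitsModCubes
import Literature.NumberTheory.QuadraticFields.ClassNumberOne
import Literature.NumberTheory.EllipticCurves.HeegnerPoints
import Mathlib.Data.Nat.Squarefree
import HarnessLib

/-!
# The field `ℚ(√-n)` of the Rédei–Reichardt theorem: prime tuple, discriminant, units, conjugation

Topic `NumberTheory/QuadraticFields`, namespace `Literature.NumberTheory.QuadraticFields.RedeiReichardt`
(towards `redeiReichardt_fourTwoCard_classGroup`, Li–Ma 2008 Thm. 0.4).  Theorem-only file (no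
definition, no named fact).

The named fact is stated for a quadratic field `K ∋ √-n` and an injective tuple `p : Fin t → ℕ` of
primes with `∏ pᵢ = 2n` (`n ≡ 1 (mod 4)`) resp. `= n` — "`p₁, …, p_t` are the distinct primes of
`D = disc K`" (Li–Ma, Lemma 0.1).  This file unpacks that hypothesis:

* `squarefree_prod_of_injective`, `squarefree_and_pos_of_prod_eq`, `dvd_or_of_prod_eq`,
  `exists_eq_of_prime_dvd` — `n` is square-free, every `pᵢ` divides `n` or is `2` with
  `n ≡ 1 (mod 4)`, and every prime of `n` is some `pᵢ`;
* `discr_eq` — **`disc K = -n` (`n ≡ 3 (mod 4)`) resp. `-4n`** (the fundamental discriminant in the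
  square class of `-n`; Li–Ma Lemma 0.1, Marcus Ch. 2 Thm. 1), `isImaginaryQuadratic`,
  `card_primeFactors_natAbs_discr` (`t = ω(|disc K|)`), `discr_lt_neg_four` and
  `units_eq_one_or_neg_one` (`𝓞_Kˣ = {±1}` once `n ∉ {1, 3}`);
* `exists_conj` — the conjugation `τ ∈ Aut(K/ℚ)`: `τ(√-n) = -√-n`, `K^τ = ℚ`, `{y : τy = -y} = ℚ√-n`.

## References

* Y. Li, L. Ma, Acta Arith. 134 (2008), Lemma 0.1. [LiMa2008]
* D. A. Marcus, *Number Fields*, 2nd ed. (2018), Ch. 2 Thm. 1 and Cor. 2 (integers and discriminant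
  of `ℚ(√m)`), Ch. 5 (units of imaginary quadratic fields). [Marcus2018]
-/

noncomputable section

open NumberField Module

namespace Literature.NumberTheory.QuadraticFields.RedeiReichardt

open Literature.NumberTheory.QuadraticFields.Quadratic

/-! ### The prime tuple -/

section Tuple

variable {t : ℕ} {p : Fin t → ℕ} (hp : ∀ i, (p i).Prime) (hinj : Function.Injective p)
include hp hinj

/-- A product of distinct primes is square-free. [cite: LiMa2008, Lemma 0.1] -/
theorem squarefree_prod_of_injective : Squarefree (∏ i, p i) := by
  classical
  have key : ∀ s : Finset (Fin t), Squarefree (∏ i ∈ s, p i) := by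
    intro s
    induction s using Finset.induction_on with
    | empty => simp
    | insert a s ha ih =>
      rw [Finset.prod_insert ha, Nat.squarefree_mul_iff]
      refine ⟨?_, (hp a).squarefree, ih⟩
      refine Nat.Coprime.prod_right fun i hi => ?_
      rw [Nat.coprime_primes (hp a) (hp i)]
      exact fun h => ha (by rwa [hinj h])
  exact key Finset.univ

variable {n : ℕ} (hprod : ∏ i, p i = if n % 4 = 1 then 2 * n else n)
include hprod

/-- `n` is square-free (it divides the square-free `∏ pᵢ`) and positive. [cite: LiMa2008, Lemma 0.1] -/
theorem squarefree_and_pos_of_prod_eq : Squarefree n ∧ 0 < n := by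
  have hsq := squarefree_prod_of_injective hp hinj
  rw [hprod] at hsq
  have hn : Squarefree n := by
    split_ifs at hsq with h
    · exact Squarefree.squarefree_of_dvd (Dvd.intro_left 2 rfl) hsq
    · exact hsq
  exact ⟨hn, Nat.pos_of_ne_zero (Squarefree.ne_zero hn)⟩

omit hinj in
/-- Each `pᵢ` divides `n`, or `pᵢ = 2` and `n ≡ 1 (mod 4)`. [cite: LiMa2008, Lemma 0.1] -/
theorem dvd_or_of_prod_eq (i : Fin t) : p i ∣ n ∨ (p i = 2 ∧ n % 4 = 1) := by
  have hdvd : p i ∣ ∏ j, p j := Finset.dvd_prod_of_mem p (Finset.mem_univ i)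
  rw [hprod] at hdvd
  split_ifs at hdvd with h
  · rcases (Nat.Prime.dvd_mul (hp i)).mp hdvd with h2 | hn
    · exact Or.inr ⟨(Nat.prime_dvd_prime_iff_eq (hp i) Nat.prime_two).mp h2, h⟩
    · exact Or.inl hn
  · exact Or.inl hdvd

omit hinj in
/-- Every prime divisor of `n` is one of the `pᵢ`. [cite: LiMa2008, Lemma 0.1] -/
theorem exists_eq_of_prime_dvd {q : ℕ} (hq : q.Prime) (hqn : q ∣ n) : ∃ i, p i = q := by
  have hdvd : q ∣ ∏ j, p j := by
    rw [hprod]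
    split_ifs
    · exact Dvd.dvd.mul_left hqn 2
    · exact hqn
  obtain ⟨i, -, hi⟩ := (Prime.dvd_finsetProd_iff hq.prime _).mp hdvd
  exact ⟨i, ((Nat.prime_dvd_prime_iff_eq hq (hp i)).mp hi).symm⟩

omit hinj in
/-- For `n ≡ 1 (mod 4)` the prime `2` is one of the `pᵢ`. [cite: LiMa2008, Lemma 0.1] -/
theorem exists_eq_two_of_prod_eq (h4 : n % 4 = 1) : ∃ i, p i = 2 := by
  have hdvd : 2 ∣ ∏ j, p j := by rw [hprod, if_pos h4]; exact Dvd.intro n rfl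
  obtain ⟨i, -, hi⟩ := (Prime.dvd_finsetProd_iff Nat.prime_two.prime _).mp hdvd
  exact ⟨i, ((Nat.prime_dvd_prime_iff_eq Nat.prime_two (hp i)).mp hi).symm⟩

/-- **`t = ω(|D|)`**: the number of primes in the tuple is the number of prime factors of
`|disc K| = n` (`n ≡ 3 (mod 4)`) resp. `4n`. [cite: LiMa2008, Lemma 0.1] -/
theorem card_eq_card_primeFactors :
    t = (if n % 4 = 3 then n else 4 * n).primeFactors.card := by
  classical
  have hsq := (squarefree_and_pos_of_prod_eq hp hinj hprod).1
  have hn0 : n ≠ 0 := Squarefree.ne_zero hsq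
  have h1 : ∏ q ∈ Finset.univ.image p, q = ∏ i, p i :=
    Finset.prod_image fun i _ j _ h => hinj h
  have himage : (∏ i, p i).primeFactors = Finset.univ.image p := by
    rw [← h1]
    exact Nat.primeFactors_prod fun q hq => by
      obtain ⟨i, -, rfl⟩ := Finset.mem_image.mp hq
      exact hp i
  have hcard : t = (∏ i, p i).primeFactors.card := by
    rw [himage, Finset.card_image_of_injective _ hinj, Finset.card_univ, Fintype.card_fin]
  rw [hcard, hprod]
  have h4n : (4 * n).primeFactors = (2 * n).primeFactors := by
    rw [show 4 * n = 2 * (2 * n) by ring, Nat.primeFactors_mul two_ne_zero (by omega),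
      Nat.primeFactors_mul two_ne_zero hn0, Nat.Prime.primeFactors Nat.prime_two]
    ext q
    simp only [Finset.mem_union, Finset.mem_singleton]
    tauto
  by_cases h1 : n % 4 = 1
  · rw [if_pos h1, if_neg (by omega), h4n]
  · rw [if_neg h1]
    by_cases h3 : n % 4 = 3
    · rw [if_pos h3]
    · rw [if_neg h3, h4n]
      -- `n` is even here (`n % 4 ∈ {0, 2}`, and `4 ∤ n`), so `2 ∣ n` and the prime factors agree
      have h2n : 2 ∣ n := by
        have : n % 4 = 0 ∨ n % 4 = 2 := by omega
        rcases this with h | h <;> omega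
      rw [Nat.primeFactors_mul two_ne_zero hn0, Nat.Prime.primeFactors Nat.prime_two]
      congr 1
      symm
      rw [Finset.union_eq_right, Finset.singleton_subset_iff]
      exact Nat.mem_primeFactors.mpr ⟨Nat.prime_two, h2n, hn0⟩

end Tuple

/-! ### The discriminant of `ℚ(√-n)` -/

section Field

variable {K : Type*} [Field K] [NumberField K] (h2 : finrank ℚ K = 2) {n : ℕ} (hn : Squarefree n)
  {x : K} (hx : x ^ 2 = -(n : K))

include hn hx in
/-- `√-n ∉ ℚ` (its square is negative). [cite: Marcus2018, Ch. 2 Thm. 1] -/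
theorem sqrt_neg_not_mem_range : x ∉ Set.range (algebraMap ℚ K) := by
  rintro ⟨q, hq⟩
  have hn0 : 0 < n := Nat.pos_of_ne_zero hn.ne_zero
  have h : algebraMap ℚ K (q ^ 2 + n) = 0 := by
    rw [map_add, map_pow, hq, hx, map_natCast]; ring
  have hq0 : q ^ 2 + n = 0 := (map_eq_zero _).mp h
  nlinarith [sq_nonneg q, (Nat.cast_pos (α := ℚ)).mpr hn0]

include hx in
/-- `x² = -n` read through `algebraMap ℚ K`. [cite: Marcus2018, Ch. 2 Thm. 1] -/
theorem sqrt_neg_sq_eq_algebraMap : x ^ 2 = algebraMap ℚ K (-(n : ℚ)) := by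
  rw [hx, map_neg, map_natCast]

include hn in
/-- The fundamental discriminant in the square class of `-n`: `-n` (`n ≡ 3 (mod 4)`) resp. `-4n` is a
fundamental discriminant for square-free `n`. [cite: Marcus2018, Ch. 2 Thm. 1] -/
theorem isFundamental_negDisc :
    ((if n % 4 = 3 then -(n : ℤ) else -4 * n) % 4 = 1 ∧
        Squarefree (if n % 4 = 3 then -(n : ℤ) else -4 * n) ∧
        (if n % 4 = 3 then -(n : ℤ) else -4 * n) ≠ 1) ∨
      (4 ∣ (if n % 4 = 3 then -(n : ℤ) else -4 * n) ∧
        ((if n % 4 = 3 then -(n : ℤ) else -4 * n) / 4 % 4 = 2 ∨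
          (if n % 4 = 3 then -(n : ℤ) else -4 * n) / 4 % 4 = 3) ∧
        Squarefree ((if n % 4 = 3 then -(n : ℤ) else -4 * n) / 4)) := by
  have hsqn : Squarefree (-(n : ℤ)) := by
    rw [← Int.squarefree_natAbs, Int.natAbs_neg, Int.natAbs_natCast]; exact hn
  have h4 : ¬ 4 ∣ n := fun h => by
    obtain ⟨k, rfl⟩ := h
    have : 2 * 2 ∣ 4 * k := ⟨k, by ring⟩
    exact absurd (Nat.isUnit_iff.mp (hn 2 this)) (by norm_num)
  by_cases h3 : n % 4 = 3
  · rw [if_pos h3]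
    left
    refine ⟨by omega, hsqn, by omega⟩
  · rw [if_neg h3]
    right
    refine ⟨⟨-n, by ring⟩, ?_, ?_⟩
    · rw [show (-4 * (n : ℤ)) / 4 = -n by omega]
      omega
    · rw [show (-4 * (n : ℤ)) / 4 = -n by omega]
      exact hsqn

include h2 hn hx in
/-- **`disc K = -n` for `n ≡ 3 (mod 4)`, `disc K = -4n` otherwise**, for a quadratic field `K ∋ √-n`,
`n` square-free (Li–Ma Lemma 0.1: `D = D₁⋯D_t`; Marcus Ch. 2 Thm. 1). [cite: LiMa2008, Lemma 0.1]
[cite: Marcus2018, Ch. 2 Thm. 1] -/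
theorem discr_eq : NumberField.discr K = if n % 4 = 3 then -(n : ℤ) else -4 * n := by
  have hθ := sqrt_neg_not_mem_range hn hx
  obtain ⟨q, hq0, hq⟩ := NumberField.exists_discr_eq_mul_sq h2 hθ (sqrt_neg_sq_eq_algebraMap hx)
  refine eq_of_isFundamental_of_eq_mul_sq (isFundamentalDiscriminant_discr h2)
    (isFundamental_negDisc hn) (q := if n % 4 = 3 then q else q / 2) ?_
  split_ifs with h3
  · rw [hq]; push_cast; ring
  · rw [hq]; push_cast; ring

include h2 hn hx in
/-- `disc K < 0`, in fact `disc K ≤ -3`. [cite: Marcus2018, Ch. 2 Thm. 1] -/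
theorem discr_neg : NumberField.discr K < 0 := by
  rw [discr_eq h2 hn hx]
  have hn0 : n ≠ 0 := Squarefree.ne_zero hn
  split_ifs <;> omega

include h2 hn hx in
/-- **`disc K < -4` once `n ∉ {1, 3}`** (then `𝓞_Kˣ = {±1}`). [cite: Marcus2018, Ch. 5 (units of imaginary quadratic fields)] -/
theorem discr_lt_neg_four (hn1 : n ≠ 1) (hn3 : n ≠ 3) : NumberField.discr K < -4 := by
  rw [discr_eq h2 hn hx]
  have hn0 : n ≠ 0 := Squarefree.ne_zero hn
  split_ifs with h <;> omega

include h2 hn hx in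
/-- `K = ℚ(√-n)` is an imaginary quadratic field. [cite: Marcus2018, Ch. 2 Thm. 1] -/
theorem isImaginaryQuadratic : Literature.NumberTheory.EllipticCurves.IsImaginaryQuadratic K := by
  refine ⟨h2, isTotallyComplex_of_quadratic (θ := x) (u := 0) (v := (n : ℚ)) ?_ ?_⟩
  · rw [map_zero, zero_mul, add_zero, map_natCast, hx, neg_add_cancel]
  · have : (0 : ℚ) < n := by exact_mod_cast Nat.pos_of_ne_zero hn.ne_zero
    nlinarith

include h2 hn hx in
/-- `ω(|disc K|) = ω(n)` resp. `ω(4n)`. [cite: LiMa2008, Lemma 0.1] -/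
theorem natAbs_discr_eq : (NumberField.discr K).natAbs = if n % 4 = 3 then n else 4 * n := by
  rw [discr_eq h2 hn hx]
  split_ifs <;> simp [Int.natAbs_neg, Int.natAbs_mul]

include h2 hn hx in
/-- **`𝓞_Kˣ = {±1}` for `n ∉ {1, 3}`.** [cite: Marcus2018, Ch. 5 (units of imaginary quadratic fields)] -/
theorem units_eq_one_or_neg_one (hn1 : n ≠ 1) (hn3 : n ≠ 3) (u : (𝓞 K)ˣ) :
    (u : 𝓞 K) = 1 ∨ (u : 𝓞 K) = -1 := by
  obtain ⟨T⟩ := nonempty_tauData (K := K) h2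
  exact T.units_eq_one_or_neg_one h2 (discr_lt_neg_four h2 hn hx hn1 hn3) u

/-! ### The conjugation -/

include h2 hn hx in
/-- **The conjugation of `ℚ(√-n)`**: an automorphism `τ` of `K/ℚ` with `τ(√-n) = -√-n`, whose fixed
points are the rationals and whose anti-fixed points are `ℚ·√-n`. [cite: Marcus2018, Ch. 2 Thm. 1] -/
theorem exists_conj : ∃ τ : K ≃ₐ[ℚ] K, τ x = -x ∧
    (∀ y : K, τ y = y → y ∈ Set.range (algebraMap ℚ K)) ∧
    (∀ y : K, τ y = -y → ∃ b : ℚ, y = algebraMap ℚ K b * x) := by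
  have hθ := sqrt_neg_not_mem_range hn hx
  have hc := sqrt_neg_sq_eq_algebraMap hx
  set c := conj h2 hθ hc with hcdef
  have hcc : c.comp c = AlgHom.id ℚ K := by
    ext y
    exact conj_conj h2 hθ hc y
  refine ⟨AlgEquiv.ofAlgHom c c hcc hcc, conj_gen h2 hθ hc, fun y hy => ?_, fun y hy => ?_⟩
  · obtain ⟨a, ha⟩ := exists_eq_algebraMap_of_conj_eq h2 hθ hc (x := y) hy
    exact ⟨a, ha.symm⟩
  · exact exists_eq_mul_of_conj_eq_neg h2 hθ hc (x := y) hy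

end Field

end Literature.NumberTheory.QuadraticFields.RedeiReichardt

end
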